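import Summits.Ventures.CertifiedManyBodySolver.Theorems.TcThermcert1Defs
import Summits.Ventures.CertifiedManyBodySolver.Observables.StiffnessThermalTrialGeneratorHook
import HarnessLib

/-!
# Route «hubbard-tc-thermcert-1», crux K2 `TcThermcert1.ThermalStiffnessCeilingBoxb10_le_9o71` (stmt-Ventures-26382), line «vertex»
# (hub-tc-therm-plan-2, registered skeleton 135a6fd895490092): its STUB S1 `stub_trialGeneratorHook`

HONEST FRAMING: one implication «certified trial-generator word ⇒ stiffness leaf»; no certificate (S4 is the crux content), no number,
no `T_c`; KT ceilings never assert superconductivity; NO lower bound on `T_c` is claimed; no summit, rung or crux statement is proved here.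
S1 of «vertex» is, byte for byte, STUB 1 `TrialGeneratorHook` of the K1 line «trialgen_b10» over the shared objects of
`Theorems/TcThermcert1Defs.lean` (p614173); it is the tree's all-generators hook `ObsThermalStiffnessSeqCeilingAtBeta_of_torusLimit_trialGeneratorWord_le`
(`Observables/StiffnessThermalTrialGeneratorHook.lean`, p610464 + p611646) read through those objects (`trialWord`, `IsTrialGenerator`).
Seat `hubbard-thermal-p4` (D-0154 (1) block (D) typist). The K1 twin is `TcThermcert1.stub_trialGeneratorHook`
(`Theorems/TcThermcert1TrialGeneratorSockets.lean`).
-/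

noncomputable section

namespace Summit.Ventures.CertifiedManyBodySolver.Theorems.TcThermcert1.Vertex

open Filter Topology
open Literature.MathematicalPhysics.QuantumLattice
open Literature.Probability.LatticeModels
open Summit.Ventures.CertifiedManyBodySolver.Observables
open Summit.Ventures.CertifiedManyBodySolver.Theorems.TcThermcert1

/-- **S1 of line «vertex» (crux K2)** = the all-generators thermal trial-generator hook over the route's shared objects.
[cite: DLS1978, §2 eqs. (22'), (27), (28)] -/
theorem stub_trialGeneratorHook : TrialGeneratorHook := by
  intro tp U n β hβ hn0 hn2 r a ha q hb
  exact ObsThermalStiffnessSeqCeilingAtBeta_of_torusLimit_trialGeneratorWord_le hβ hn0 hn2 r a ha.1 ha.2.1 ha.2.2.1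
    ha.2.2.2 hb

end Summit.Ventures.CertifiedManyBodySolver.Theorems.TcThermcert1.Vertex
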